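import Summits.CriticalPhenomena.PercolationContinuityZ3.Theorems.Transplant.FKConnectivityAllQPat3KNetK4Sep
import Summits.CriticalPhenomena.PercolationContinuityZ3.Theorems.Transplant.FKConnectivityAllQPat3KNetPlaceSteps
import Summits.CriticalPhenomena.PercolationContinuityZ3.Theorems.Transplant.FKConnectivityAllQPat3KNetSPSteps
import Summits.CriticalPhenomena.PercolationContinuityZ3.Theorems.Transplant.FKConnectivityAllQPat3KNetOps
import Summits.CriticalPhenomena.PercolationContinuityZ3.Theorems.Transplant.FKConnectivityAllQPat3KNetT2
import Summits.CriticalPhenomena.PercolationContinuityZ3.Theorems.Transplant.FKConnectivityAllQPat3VeeLeafK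
import Summits.CriticalPhenomena.PercolationContinuityZ3.Theorems.Transplant.FKConnectivityAllQPat3MinorInduction
import HarnessLib

/-!
# Connectivity correlation inequalities for `φ_{w,q}`, every `q > 0` — THEOREM SP(𝒦): the generic VEE* placement lemma

Helper file (`--supports stmt-CriticalPhenomena-4575`), census lineage (gen 41) of LANE 2's FK sub-programme; builds on p205010 (kernel
theorem, internal audit signed; external expert review pending).  No definitions, no named facts; standard axioms.

`FK.placeK_vee`: on a `K₄` with six 𝒦-slots (`FK.K4Sep`, corners `a b c d`), marks the corner `a` and inner vertices `s ∈ Qbc`,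
`t ∈ Qbd`, every minor `(E, C)` is SP-good at `(a, s, t)` — given the outer induction hypothesis of THEOREM SP(𝒦) below `N₀ ⊇ N`.
Steps (census g41 drafts/README): shrink the mark-free slots `ab, ac, ad, cd` with ≥ 2 edges («Pat3KNetPlaceSteps» + `K4Sep.shrink_ab`
under the corner relabelings), make the remaining ones single edges, erase those outside `E ∪ C`, double away those in `E ∩ C`, and close
with the K-state VEE* leaf «Pat3VeeLeafK».  The four `vee` specs of «…KNetSPLeavesI» are instances under corner relabelings.
[cite: AyyerLinussonRavichandran2025, §7 (p. 22)]
-/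

namespace Summit.CriticalPhenomena.PercolationContinuityZ3.Theorems

namespace FK

open scoped Classical

variable {V : Type*} [Fintype V] {N₀ : Finset (Sym2 V)}

section Shrink4

variable {Qab Qac Qad Qbc Qbd Qcd : Finset (Sym2 V)} {a b c d m₁ m₂ m₃ : V}

/-- **Shrinking the slot `ab` of a `K₄` with 𝒦-slots** (three marks off the interior of `Qab`): SP-goodness of every minor follows from
the outer induction hypothesis. [cite: AyyerLinussonRavichandran2025, §7 (p. 22)] -/
theorem K4Sep.spGoodC_shrink_ab
    (ihSP : ∀ {N' E' C' : Finset (Sym2 V)} {x' y' b' s' t' : V}, N'.card < N₀.card → IsKNet N' x' y' → E' ⊆ N' → C' ⊆ N' →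
      (∃ e ∈ N', b' ∈ e) → (∃ e ∈ N', s' ∈ e) → (∃ e ∈ N', t' ∈ e) → b' ≠ s' → b' ≠ t' → s' ≠ t' → SPGoodC E' C' b' s' t')
    (h : K4Sep Qab Qac Qad Qbc Qbd Qcd a b c d) (hab : IsKNet Qab a b) (hac : IsKNet Qac a c) (had : IsKNet Qad a d)
    (hbc : IsKNet Qbc b c) (hbd : IsKNet Qbd b d) (hcd : IsKNet Qcd c d) (h2 : 2 ≤ Qab.card)
    (hN : Qab ∪ (Qac ∪ Qad ∪ Qbc ∪ Qbd ∪ Qcd) ⊆ N₀)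
    (hm₁ : ∃ e ∈ Qab ∪ (Qac ∪ Qad ∪ Qbc ∪ Qbd ∪ Qcd), m₁ ∈ e) (hm₂ : ∃ e ∈ Qab ∪ (Qac ∪ Qad ∪ Qbc ∪ Qbd ∪ Qcd), m₂ ∈ e)
    (hm₃ : ∃ e ∈ Qab ∪ (Qac ∪ Qad ∪ Qbc ∪ Qbd ∪ Qcd), m₃ ∈ e)
    (h₁ : (∃ e ∈ Qab, m₁ ∈ e) → m₁ = a ∨ m₁ = b) (h₂' : (∃ e ∈ Qab, m₂ ∈ e) → m₂ = a ∨ m₂ = b)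
    (h₃ : (∃ e ∈ Qab, m₃ ∈ e) → m₃ = a ∨ m₃ = b) (d12 : m₁ ≠ m₂) (d13 : m₁ ≠ m₃) (d23 : m₂ ≠ m₃)
    {E C : Finset (Sym2 V)} (hE : E ⊆ Qab ∪ (Qac ∪ Qad ∪ Qbc ∪ Qbd ∪ Qcd)) (hC : C ⊆ Qab ∪ (Qac ∪ Qad ∪ Qbc ∪ Qbd ∪ Qcd)) :
    SPGoodC E C m₁ m₂ m₃ := by
  have eN : Qab ∪ (Qac ∪ Qad ∪ Qbc ∪ Qbd ∪ Qcd) = (Qac ∪ Qad ∪ Qbc ∪ Qbd ∪ Qcd) ∪ Qab := Finset.union_comm _ _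
  rw [eN] at hN hm₁ hm₂ hm₃ hE hC
  have h' := h.shrink_ab hac had hbc hbd
  have hN' : IsKNet ((Qac ∪ Qad ∪ Qbc ∪ Qbd ∪ Qcd) ∪ {s(a, b)}) a b := by
    rw [Finset.union_comm]; exact h'.isKNet (IsKNet.edge hab.ne) hac had hbc hbd hcd
  have hdRQ : Disjoint (Qac ∪ Qad ∪ Qbc ∪ Qbd ∪ Qcd) Qab :=
    Finset.disjoint_union_left.2 ⟨Finset.disjoint_union_left.2 ⟨Finset.disjoint_union_left.2 ⟨Finset.disjoint_union_left.2
      ⟨h.d_ab_ac.symm, h.d_ab_ad.symm⟩, h.d_ab_bc.symm⟩, h.d_ab_bd.symm⟩, h.d_ab_cd.symm⟩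
  have hRQ : ∀ w : V, (∃ e ∈ Qac ∪ Qad ∪ Qbc ∪ Qbd ∪ Qcd, w ∈ e) → (∃ e ∈ Qab, w ∈ e) → w = a ∨ w = b := by
    intro w hw hwQ
    obtain ⟨e, he, hwe⟩ := hw
    simp only [Finset.mem_union] at he
    rcases he with (((he | he) | he) | he) | he
    · exact Or.inl (h.v_ab_ac w hwQ ⟨e, he, hwe⟩)
    · exact Or.inl (h.v_ab_ad w hwQ ⟨e, he, hwe⟩)
    · exact Or.inr (h.v_ab_bc w hwQ ⟨e, he, hwe⟩)
    · exact Or.inr (h.v_ab_bd w hwQ ⟨e, he, hwe⟩)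
    · exact (h.v_ab_cd w hwQ ⟨e, he, hwe⟩).elim
  have heR : s(a, b) ∉ Qac ∪ Qad ∪ Qbc ∪ Qbd ∪ Qcd := by
    intro he
    simp only [Finset.mem_union] at he
    rcases he with (((he | he) | he) | he) | he
    · exact Finset.disjoint_singleton_left.1 h'.d_ab_ac he
    · exact Finset.disjoint_singleton_left.1 h'.d_ab_ad he
    · exact Finset.disjoint_singleton_left.1 h'.d_ab_bc he
    · exact Finset.disjoint_singleton_left.1 h'.d_ab_bd he
    · exact Finset.disjoint_singleton_left.1 h'.d_ab_cd he
  exact spGoodC_of_shrink ihSP hdRQ hRQ hab h2 heR hN' hN hm₁ hm₂ hm₃ h₁ h₂' h₃ d12 d13 d23 hE hC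

end Shrink4

section PlaceVee

variable {Qab Qac Qad Qbc Qbd Qcd : Finset (Sym2 V)} {a b c d s t : V}

/-- **THE VEE* PLACEMENT LEMMA ON A `K₄` WITH 𝒦-SLOTS** (census g41): marks the corner `a`, `s` inner in `Qbc`, `t` inner in `Qbd`.
[cite: AyyerLinussonRavichandran2025, §7 (p. 22)] -/
theorem placeK_vee
    (ihSP : ∀ {N' E' C' : Finset (Sym2 V)} {x' y' b' s' t' : V}, N'.card < N₀.card → IsKNet N' x' y' → E' ⊆ N' → C' ⊆ N' →
      (∃ e ∈ N', b' ∈ e) → (∃ e ∈ N', s' ∈ e) → (∃ e ∈ N', t' ∈ e) → b' ≠ s' → b' ≠ t' → s' ≠ t' → SPGoodC E' C' b' s' t')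
    (h : K4Sep Qab Qac Qad Qbc Qbd Qcd a b c d) (hab : IsKNet Qab a b) (hac : IsKNet Qac a c) (had : IsKNet Qad a d)
    (hbc : IsKNet Qbc b c) (hbd : IsKNet Qbd b d) (hcd : IsKNet Qcd c d)
    (hN : Qab ∪ (Qac ∪ Qad ∪ Qbc ∪ Qbd ∪ Qcd) ⊆ N₀)
    (hs : ∃ e ∈ Qbc, s ∈ e) (hsb : s ≠ b) (hsc : s ≠ c) (ht : ∃ e ∈ Qbd, t ∈ e) (htb : t ≠ b) (htd : t ≠ d)
    {E C : Finset (Sym2 V)} (hE : E ⊆ Qab ∪ (Qac ∪ Qad ∪ Qbc ∪ Qbd ∪ Qcd)) (hC : C ⊆ Qab ∪ (Qac ∪ Qad ∪ Qbc ∪ Qbd ∪ Qcd)) :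
    SPGoodC E C a s t := by
  -- distinctness of the marks and the corners
  have has : a ≠ s := fun e => hab.ne (h.v_ab_bc a hab.left_mem (e ▸ hs))
  have hat : a ≠ t := fun e => hab.ne (h.v_ab_bd a hab.left_mem (e ▸ ht))
  have hst : s ≠ t := fun e => hsb (h.v_bc_bd s hs (e ▸ ht))
  have ha_bc : ¬ ∃ e ∈ Qbc, a ∈ e := fun hh => hab.ne (h.v_ab_bc a hab.left_mem hh)
  have ha_bd : ¬ ∃ e ∈ Qbd, a ∈ e := fun hh => hab.ne (h.v_ab_bd a hab.left_mem hh)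
  have ha_cd : ¬ ∃ e ∈ Qcd, a ∈ e := fun hh => hac.ne (h.v_ac_cd a hac.left_mem hh)
  have hs_ab : ¬ ∃ e ∈ Qab, s ∈ e := fun hh => hsb (h.v_ab_bc s hh hs)
  have hs_ac : ¬ ∃ e ∈ Qac, s ∈ e := fun hh => hsc (h.v_ac_bc s hh hs)
  have hs_ad : ¬ ∃ e ∈ Qad, s ∈ e := fun hh => h.v_ad_bc s hh hs
  have hs_bd : ¬ ∃ e ∈ Qbd, s ∈ e := fun hh => hsb (h.v_bc_bd s hs hh)
  have hs_cd : ¬ ∃ e ∈ Qcd, s ∈ e := fun hh => hsc (h.v_bc_cd s hs hh)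
  have ht_ab : ¬ ∃ e ∈ Qab, t ∈ e := fun hh => htb (h.v_ab_bd t hh ht)
  have ht_ac : ¬ ∃ e ∈ Qac, t ∈ e := fun hh => h.v_ac_bd t hh ht
  have ht_ad : ¬ ∃ e ∈ Qad, t ∈ e := fun hh => htd (h.v_ad_bd t hh ht)
  have ht_bc : ¬ ∃ e ∈ Qbc, t ∈ e := fun hh => htb (h.v_bc_bd t hh ht)
  have ht_cd : ¬ ∃ e ∈ Qcd, t ∈ e := fun hh => htd (h.v_bd_cd t ht hh)
  -- marks on `N` (in any union order)
  have maN : ∀ {M : Finset (Sym2 V)}, Qab ⊆ M → ∃ e ∈ M, a ∈ e := fun hM => by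
    obtain ⟨e, he, hae⟩ := hab.left_mem; exact ⟨e, hM he, hae⟩
  have msN : ∀ {M : Finset (Sym2 V)}, Qbc ⊆ M → ∃ e ∈ M, s ∈ e := fun hM => by
    obtain ⟨e, he, hse⟩ := hs; exact ⟨e, hM he, hse⟩
  have mtN : ∀ {M : Finset (Sym2 V)}, Qbd ⊆ M → ∃ e ∈ M, t ∈ e := fun hM => by
    obtain ⟨e, he, hte⟩ := ht; exact ⟨e, hM he, hte⟩
  have sub : ∀ {Q M : Finset (Sym2 V)}, (∀ e, e ∈ Q → e ∈ M) → Q ⊆ M := fun hh e he => hh e he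
  -- STEP 1: shrink the mark-free slots with at least two edges
  by_cases h2ab : 2 ≤ Qab.card
  · exact K4Sep.spGoodC_shrink_ab ihSP h hab hac had hbc hbd hcd h2ab hN (maN (sub fun e he => by simp [he]))
      (msN (sub fun e he => by simp [he])) (mtN (sub fun e he => by simp [he])) (fun _ => Or.inl rfl)
      (fun hh => (hs_ab hh).elim) (fun hh => (ht_ab hh).elim) has hat hst hE hC
  by_cases h2ac : 2 ≤ Qac.card
  · have eN : Qab ∪ (Qac ∪ Qad ∪ Qbc ∪ Qbd ∪ Qcd) = Qac ∪ (Qab ∪ Qad ∪ Qbc ∪ Qcd ∪ Qbd) := by ac_rfl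
    rw [eN] at hN hE hC
    exact K4Sep.spGoodC_shrink_ab ihSP h.swap_bc hac hab had hbc.symm hcd hbd h2ac hN (maN (sub fun e he => by simp [he]))
      (msN (sub fun e he => by simp [he])) (mtN (sub fun e he => by simp [he])) (fun _ => Or.inl rfl)
      (fun hh => (hs_ac hh).elim) (fun hh => (ht_ac hh).elim) has hat hst hE hC
  by_cases h2ad : 2 ≤ Qad.card
  · have eN : Qab ∪ (Qac ∪ Qad ∪ Qbc ∪ Qbd ∪ Qcd) = Qad ∪ (Qab ∪ Qac ∪ Qbd ∪ Qcd ∪ Qbc) := by ac_rfl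
    rw [eN] at hN hE hC
    exact K4Sep.spGoodC_shrink_ab ihSP h.swap_cd.swap_bc had hab hac hbd.symm hcd.symm hbc h2ad hN
      (maN (sub fun e he => by simp [he])) (msN (sub fun e he => by simp [he])) (mtN (sub fun e he => by simp [he]))
      (fun _ => Or.inl rfl) (fun hh => (hs_ad hh).elim) (fun hh => (ht_ad hh).elim) has hat hst hE hC
  by_cases h2cd : 2 ≤ Qcd.card
  · have eN : Qab ∪ (Qac ∪ Qad ∪ Qbc ∪ Qbd ∪ Qcd) = Qcd ∪ (Qbc ∪ Qac ∪ Qbd ∪ Qad ∪ Qab) := by ac_rfl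
    rw [eN] at hN hE hC
    exact K4Sep.spGoodC_shrink_ab ihSP h.swap_ac.swap_cd.swap_bc hcd hbc.symm hac.symm hbd.symm had.symm hab.symm h2cd hN
      (maN (sub fun e he => by simp [he])) (msN (sub fun e he => by simp [he])) (mtN (sub fun e he => by simp [he]))
      (fun hh => (ha_cd hh).elim) (fun hh => (hs_cd hh).elim) (fun hh => (ht_cd hh).elim) has hat hst hE hC
  -- STEP 2: the four mark-free slots are single edges
  obtain rfl : Qab = {s(a, b)} := hab.eq_singleton_of_card_le_one (by omega)
  obtain rfl : Qac = {s(a, c)} := hac.eq_singleton_of_card_le_one (by omega)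
  obtain rfl : Qad = {s(a, d)} := had.eq_singleton_of_card_le_one (by omega)
  obtain rfl : Qcd = {s(c, d)} := hcd.eq_singleton_of_card_le_one (by omega)
  -- the ambient network after STEP 2
  have inN : ∀ {f : Sym2 V}, (f ∈ ({s(a, b)} : Finset (Sym2 V)) ∨ f ∈ ({s(a, c)} : Finset (Sym2 V)) ∨ f ∈ ({s(a, d)} : Finset (Sym2 V)) ∨
      f ∈ Qbc ∨ f ∈ Qbd ∨ f ∈ ({s(c, d)} : Finset (Sym2 V))) →
      f ∈ ({s(a, b)} : Finset (Sym2 V)) ∪ ({s(a, c)} ∪ {s(a, d)} ∪ Qbc ∪ Qbd ∪ {s(c, d)}) := by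
    intro f hf
    simp only [Finset.mem_union]
    rcases hf with h1 | h1 | h1 | h1 | h1 | h1
    exacts [Or.inl h1, Or.inr (Or.inl (Or.inl (Or.inl (Or.inl h1)))), Or.inr (Or.inl (Or.inl (Or.inl (Or.inr h1)))),
      Or.inr (Or.inl (Or.inl (Or.inr h1))), Or.inr (Or.inl (Or.inr h1)), Or.inr (Or.inr h1)]
  have outN : ∀ {f : Sym2 V}, f ∈ ({s(a, b)} : Finset (Sym2 V)) ∪ ({s(a, c)} ∪ {s(a, d)} ∪ Qbc ∪ Qbd ∪ {s(c, d)}) →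
      f = s(a, b) ∨ f = s(a, c) ∨ f = s(a, d) ∨ f ∈ Qbc ∨ f ∈ Qbd ∨ f = s(c, d) := by
    intro f hf
    simp only [Finset.mem_union, Finset.mem_singleton] at hf
    rcases hf with h1 | (((h1 | h1) | h1) | h1) | h1
    exacts [Or.inl h1, Or.inr (Or.inl h1), Or.inr (Or.inr (Or.inl h1)), Or.inr (Or.inr (Or.inr (Or.inl h1))),
      Or.inr (Or.inr (Or.inr (Or.inr (Or.inl h1)))), Or.inr (Or.inr (Or.inr (Or.inr (Or.inr h1))))]
  have hsbc : ∃ e ∈ Qbc, s ∈ e := hs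
  have htbd : ∃ e ∈ Qbd, t ∈ e := ht
  -- plain edges are pairwise distinct and off the marked slots
  have nab_bc : s(a, b) ∉ Qbc := Finset.disjoint_singleton_left.1 h.d_ab_bc
  have nab_bd : s(a, b) ∉ Qbd := Finset.disjoint_singleton_left.1 h.d_ab_bd
  have nac_bc : s(a, c) ∉ Qbc := Finset.disjoint_singleton_left.1 h.d_ac_bc
  have nac_bd : s(a, c) ∉ Qbd := Finset.disjoint_singleton_left.1 h.d_ac_bd
  have nad_bc : s(a, d) ∉ Qbc := Finset.disjoint_singleton_left.1 h.d_ad_bc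
  have nad_bd : s(a, d) ∉ Qbd := Finset.disjoint_singleton_left.1 h.d_ad_bd
  have ncd_bc : s(c, d) ∉ Qbc := Finset.disjoint_singleton_right.1 h.d_bc_cd
  have ncd_bd : s(c, d) ∉ Qbd := Finset.disjoint_singleton_right.1 h.d_bd_cd
  have dab_ac : s(a, b) ≠ s(a, c) := fun e => Finset.disjoint_singleton_left.1 h.d_ab_ac (e ▸ Finset.mem_singleton_self _)
  have dab_ad : s(a, b) ≠ s(a, d) := fun e => Finset.disjoint_singleton_left.1 h.d_ab_ad (e ▸ Finset.mem_singleton_self _)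
  have dab_cd : s(a, b) ≠ s(c, d) := fun e => Finset.disjoint_singleton_left.1 h.d_ab_cd (e ▸ Finset.mem_singleton_self _)
  have dac_ad : s(a, c) ≠ s(a, d) := fun e => Finset.disjoint_singleton_left.1 h.d_ac_ad (e ▸ Finset.mem_singleton_self _)
  have dac_cd : s(a, c) ≠ s(c, d) := fun e => Finset.disjoint_singleton_left.1 h.d_ac_cd (e ▸ Finset.mem_singleton_self _)
  have dad_cd : s(a, d) ≠ s(c, d) := fun e => Finset.disjoint_singleton_left.1 h.d_ad_cd (e ▸ Finset.mem_singleton_self _)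
  have ma_ac : ∃ e ∈ ({s(a, c)} : Finset (Sym2 V)), a ∈ e := ⟨_, Finset.mem_singleton_self _, Sym2.mem_mk_left _ _⟩
  have ma_ab : ∃ e ∈ ({s(a, b)} : Finset (Sym2 V)), a ∈ e := ⟨_, Finset.mem_singleton_self _, Sym2.mem_mk_left _ _⟩
  -- STEP 3: a plain slot outside `E ∪ C` is erased
  by_cases x_ab : s(a, b) ∈ E ∨ s(a, b) ∈ C
  swap
  · have hM : IsKNet ({s(a, c)} ∪ {s(a, d)} ∪ Qbc ∪ Qbd ∪ {s(c, d)}) a b := IsKNet.bridge hac had hbc hbd hcd h.toBridgeSep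
    refine spGoodC_of_erase ihSP (e := s(a, b)) (inN (Or.inl (Finset.mem_singleton_self _))) (fun hh => ?_)
      Finset.subset_union_right (by rw [Finset.insert_eq]) hM hN ?_ ?_ ?_ has hat hst hE hC (fun hh => x_ab (Or.inl hh))
      (fun hh => x_ab (Or.inr hh))
    · -- `ab` is not among the other five slots
      simp only [Finset.mem_union, Finset.mem_singleton] at hh
      rcases hh with (((e | e) | e) | e) | e
      exacts [dab_ac e, dab_ad e, nab_bc e, nab_bd e, dab_cd e]
    · exact ⟨_, by simp, Sym2.mem_mk_left a c⟩
    · obtain ⟨e, he, hse⟩ := hsbc; exact ⟨e, by simp only [Finset.mem_union]; exact Or.inl (Or.inl (Or.inr he)), hse⟩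
    · obtain ⟨e, he, hte⟩ := htbd; exact ⟨e, by simp only [Finset.mem_union]; exact Or.inl (Or.inr he), hte⟩
  by_cases x_ac : s(a, c) ∈ E ∨ s(a, c) ∈ C
  swap
  · have hM : IsKNet ({s(a, b)} ∪ {s(a, d)} ∪ Qbc ∪ {s(c, d)} ∪ Qbd) a c :=
      IsKNet.bridge hab had hbc.symm hcd hbd h.swap_bc.toBridgeSep
    refine spGoodC_of_erase ihSP (e := s(a, c)) (inN (Or.inr (Or.inl (Finset.mem_singleton_self _)))) (fun hh => ?_) ?_ ?_ hM hN
      ⟨_, Finset.mem_union_left _ (Finset.mem_union_left _ (Finset.mem_union_left _ (Finset.mem_union_left _ (Finset.mem_singleton_self _)))), Sym2.mem_mk_left a b⟩ ?_ ?_ has hat hst hE hC (fun hh => x_ac (Or.inl hh))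
      (fun hh => x_ac (Or.inr hh))
    · simp only [Finset.mem_union, Finset.mem_singleton] at hh
      rcases hh with (((e | e) | e) | e) | e
      exacts [dab_ac e.symm, dac_ad e, nac_bc e, dac_cd e, nac_bd e]
    · intro f hf
      simp only [Finset.mem_union] at hf
      rcases hf with (((e | e) | e) | e) | e
      exacts [inN (Or.inl e), inN (Or.inr (Or.inr (Or.inl e))), inN (Or.inr (Or.inr (Or.inr (Or.inl e)))),
        inN (Or.inr (Or.inr (Or.inr (Or.inr (Or.inr e))))), inN (Or.inr (Or.inr (Or.inr (Or.inr (Or.inl e)))))]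
    · intro f hf
      rw [Finset.mem_insert]; simp only [Finset.mem_union, Finset.mem_singleton]
      rcases outN hf with e | e | e | e | e | e
      exacts [Or.inr (Or.inl (Or.inl (Or.inl (Or.inl e)))), Or.inl e, Or.inr (Or.inl (Or.inl (Or.inl (Or.inr e)))),
        Or.inr (Or.inl (Or.inl (Or.inr e))), Or.inr (Or.inr e), Or.inr (Or.inl (Or.inr e))]
    · obtain ⟨e, he, hse⟩ := hsbc; exact ⟨e, by simp only [Finset.mem_union]; exact Or.inl (Or.inl (Or.inr he)), hse⟩
    · obtain ⟨e, he, hte⟩ := htbd; exact ⟨e, by simp only [Finset.mem_union]; exact Or.inr he, hte⟩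
  by_cases x_ad : s(a, d) ∈ E ∨ s(a, d) ∈ C
  swap
  · have hM : IsKNet ({s(a, b)} ∪ {s(a, c)} ∪ Qbd ∪ {s(c, d)} ∪ Qbc) a d :=
      IsKNet.bridge hab hac hbd.symm hcd.symm hbc h.swap_cd.swap_bc.toBridgeSep
    refine spGoodC_of_erase ihSP (e := s(a, d)) (inN (Or.inr (Or.inr (Or.inl (Finset.mem_singleton_self _))))) (fun hh => ?_) ?_ ?_
      hM hN ⟨_, Finset.mem_union_left _ (Finset.mem_union_left _ (Finset.mem_union_left _ (Finset.mem_union_left _ (Finset.mem_singleton_self _)))), Sym2.mem_mk_left a b⟩ ?_ ?_ has hat hst hE hC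
      (fun hh => x_ad (Or.inl hh)) (fun hh => x_ad (Or.inr hh))
    · simp only [Finset.mem_union, Finset.mem_singleton] at hh
      rcases hh with (((e | e) | e) | e) | e
      exacts [dab_ad e.symm, dac_ad e.symm, nad_bd e, dad_cd e, nad_bc e]
    · intro f hf
      simp only [Finset.mem_union] at hf
      rcases hf with (((e | e) | e) | e) | e
      exacts [inN (Or.inl e), inN (Or.inr (Or.inl e)), inN (Or.inr (Or.inr (Or.inr (Or.inr (Or.inl e))))),
        inN (Or.inr (Or.inr (Or.inr (Or.inr (Or.inr e))))), inN (Or.inr (Or.inr (Or.inr (Or.inl e))))]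
    · intro f hf
      rw [Finset.mem_insert]; simp only [Finset.mem_union, Finset.mem_singleton]
      rcases outN hf with e | e | e | e | e | e
      exacts [Or.inr (Or.inl (Or.inl (Or.inl (Or.inl e)))), Or.inr (Or.inl (Or.inl (Or.inl (Or.inr e)))), Or.inl e,
        Or.inr (Or.inr e), Or.inr (Or.inl (Or.inl (Or.inr e))), Or.inr (Or.inl (Or.inr e))]
    · obtain ⟨e, he, hse⟩ := hsbc; exact ⟨e, by simp only [Finset.mem_union]; exact Or.inr he, hse⟩
    · obtain ⟨e, he, hte⟩ := htbd; exact ⟨e, by simp only [Finset.mem_union]; exact Or.inl (Or.inl (Or.inr he)), hte⟩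
  by_cases x_cd : s(c, d) ∈ E ∨ s(c, d) ∈ C
  swap
  · have hM : IsKNet (Qbc ∪ {s(a, c)} ∪ Qbd ∪ {s(a, d)} ∪ {s(a, b)}) c d :=
      IsKNet.bridge hbc.symm hac.symm hbd.symm had.symm hab.symm h.swap_ac.swap_cd.swap_bc.toBridgeSep
    refine spGoodC_of_erase ihSP (e := s(c, d)) (inN (Or.inr (Or.inr (Or.inr (Or.inr (Or.inr (Finset.mem_singleton_self _)))))))
      (fun hh => ?_) ?_ ?_ hM hN ?_ ?_ ?_ has hat hst hE hC (fun hh => x_cd (Or.inl hh)) (fun hh => x_cd (Or.inr hh))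
    · simp only [Finset.mem_union, Finset.mem_singleton] at hh
      rcases hh with (((e | e) | e) | e) | e
      exacts [ncd_bc e, dac_cd e.symm, ncd_bd e, dad_cd e.symm, dab_cd e.symm]
    · intro f hf
      simp only [Finset.mem_union] at hf
      rcases hf with (((e | e) | e) | e) | e
      exacts [inN (Or.inr (Or.inr (Or.inr (Or.inl e)))), inN (Or.inr (Or.inl e)), inN (Or.inr (Or.inr (Or.inr (Or.inr (Or.inl e))))),
        inN (Or.inr (Or.inr (Or.inl e))), inN (Or.inl e)]
    · intro f hf
      rw [Finset.mem_insert]; simp only [Finset.mem_union, Finset.mem_singleton]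
      rcases outN hf with e | e | e | e | e | e
      exacts [Or.inr (Or.inr e), Or.inr (Or.inl (Or.inl (Or.inl (Or.inr e)))), Or.inr (Or.inl (Or.inr e)),
        Or.inr (Or.inl (Or.inl (Or.inl (Or.inl e)))), Or.inr (Or.inl (Or.inl (Or.inr e))), Or.inl e]
    · exact ⟨_, Finset.mem_union_left _ (Finset.mem_union_left _ (Finset.mem_union_left _ (Finset.mem_union_right _ (Finset.mem_singleton_self _)))), Sym2.mem_mk_left a c⟩
    · obtain ⟨e, he, hse⟩ := hsbc; exact ⟨e, by simp only [Finset.mem_union]; exact Or.inl (Or.inl (Or.inl (Or.inl he))), hse⟩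
    · obtain ⟨e, he, hte⟩ := htbd; exact ⟨e, by simp only [Finset.mem_union]; exact Or.inl (Or.inl (Or.inr he)), hte⟩
  -- STEP 4: plain slots of `E ∩ C` are doubled away
  set P4 : Finset (Sym2 V) := {s(a, b), s(a, c), s(a, d), s(c, d)} with hP4
  have hPEC : ∀ e ∈ P4, e ∈ E ∨ e ∈ C := by
    intro e he
    simp only [hP4, Finset.mem_insert, Finset.mem_singleton] at he
    rcases he with rfl | rfl | rfl | rfl
    exacts [x_ab, x_ac, x_ad, x_cd]
  have hNP : ∀ e ∈ ({s(a, b)} : Finset (Sym2 V)) ∪ ({s(a, c)} ∪ {s(a, d)} ∪ Qbc ∪ Qbd ∪ {s(c, d)}), e ∉ Qbc → e ∉ Qbd → e ∈ P4 := by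
    intro e he h1 h2
    simp only [hP4, Finset.mem_insert, Finset.mem_singleton]
    rcases outN he with e' | e' | e' | e' | e' | e'
    exacts [Or.inl e', Or.inr (Or.inl e'), Or.inr (Or.inr (Or.inl e')), absurd e' h1, absurd e' h2, Or.inr (Or.inr (Or.inr e'))]
  have hPQ1 : ∀ e ∈ P4, e ∉ Qbc := by
    intro e he
    simp only [hP4, Finset.mem_insert, Finset.mem_singleton] at he
    rcases he with rfl | rfl | rfl | rfl
    exacts [nab_bc, nac_bc, nad_bc, ncd_bc]
  have hPQ2 : ∀ e ∈ P4, e ∉ Qbd := by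
    intro e he
    simp only [hP4, Finset.mem_insert, Finset.mem_singleton] at he
    rcases he with rfl | rfl | rfl | rfl
    exacts [nab_bd, nac_bd, nad_bd, ncd_bd]
  refine SPGoodC.of_sdiff (D := C ∩ P4) Finset.inter_subset_left ?_
  set E' : Finset (Sym2 V) := E \ (C ∩ P4) with hE'
  have hE'E : E' ⊆ E := Finset.sdiff_subset
  -- STEP 5: the K-state VEE* leaf
  have hct : c ≠ t := fun e => hbc.ne (h.v_bc_bd c hbc.right_mem (e ▸ ht)).symm
  have hds : d ≠ s := fun e => hbd.ne (h.v_bc_bd d (e ▸ hs) hbd.right_mem).symm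
  have hd_bc : ¬ ∃ e ∈ Qbc, d ∈ e := fun hh => hbd.ne (h.v_bc_bd d hh hbd.right_mem).symm
  have hc_bd : ¬ ∃ e ∈ Qbd, c ∈ e := fun hh => hbc.ne (h.v_bc_bd c hbc.right_mem hh).symm
  set p : Fin 6 → V := ![a, b, c, d, s, t] with hp
  have hinj : Function.Injective p :=
    injective_vec6 hab.ne hac.ne had.ne has hat hbc.ne hbd.ne hsb.symm htb.symm hcd.ne hsc.symm hct hds htd.symm hst
  have hPS : plainSet p skelVee = P4 := by
    ext e
    rw [mem_plainSet_iff]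
    simp only [skelVee, List.mem_cons, List.not_mem_nil, or_false, hP4, Finset.mem_insert, Finset.mem_singleton, pedge]
    constructor
    · rintro ⟨e₀, he₀, rfl⟩
      rcases he₀ with rfl | rfl | rfl | rfl <;> simp [hp]
    · rintro (rfl | rfl | rfl | rfl)
      exacts [⟨(0, 1), Or.inl rfl, rfl⟩, ⟨(0, 2), Or.inr (Or.inl rfl), rfl⟩, ⟨(0, 3), Or.inr (Or.inr (Or.inl rfl)), rfl⟩,
        ⟨(2, 3), Or.inr (Or.inr (Or.inr rfl)), rfl⟩]
  have hLK : (skelVee.filter (fun e => decide (pedge p e ∈ E')), skelVee.filter (fun e => decide (pedge p e ∈ C))) ∈ splits skelVee := by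
    refine filter_mem_splits skelVee _ _ fun e₀ he₀ => ?_
    have hP : pedge p e₀ ∈ P4 := by rw [← hPS]; exact (mem_plainSet_iff p skelVee _).2 ⟨e₀, he₀, rfl⟩
    by_cases hc : pedge p e₀ ∈ C
    · have hn : pedge p e₀ ∉ E' := fun h' => (Finset.mem_sdiff.1 h').2 (Finset.mem_inter.2 ⟨hc, hP⟩)
      simp [hc, hn]
    · have hy : pedge p e₀ ∈ E' := Finset.mem_sdiff.2 ⟨(hPEC _ hP).resolve_right hc, fun h' => hc (Finset.mem_inter.1 h').1⟩
      simp [hc, hy]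
  have hp1 : ∀ j, p j ∈ {z : V | ∃ e ∈ Qbc, z ∈ e} → p j = p 1 ∨ p j = p 2 ∨ p j = p 4 := by
    intro j hj
    fin_cases j
    · exact absurd hj ha_bc
    · exact Or.inl rfl
    · exact Or.inr (Or.inl rfl)
    · exact absurd hj hd_bc
    · exact Or.inr (Or.inr rfl)
    · exact absurd hj ht_bc
  have hp2 : ∀ j, p j ∈ {z : V | ∃ e ∈ Qbd, z ∈ e} → p j = p 1 ∨ p j = p 3 ∨ p j = p 5 := by
    intro j hj
    fin_cases j
    · exact absurd hj ha_bd
    · exact Or.inl rfl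
    · exact absurd hj hc_bd
    · exact Or.inr (Or.inl rfl)
    · exact absurd hj hs_bd
    · exact Or.inr (Or.inr rfl)
  have h12 : ∀ z ∈ {z : V | ∃ e ∈ Qbc, z ∈ e}, z ∈ {z : V | ∃ e ∈ Qbd, z ∈ e} → z = p 1 ∨ z = p 3 :=
    fun z h1 h2 => Or.inl (h.v_bc_bd z h1 h2)
  have gE1 := span_sub_of_subset (fun e he z hz => (⟨e, Finset.mem_coe.1 he, hz⟩ : z ∈ {z : V | ∃ e ∈ Qbc, z ∈ e}))
    (Finset.inter_subset_right (s₁ := E')) (Finset.inter_subset_right (s₁ := C))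
  have gE2 := span_sub_of_subset (fun e he z hz => (⟨e, Finset.mem_coe.1 he, hz⟩ : z ∈ {z : V | ∃ e ∈ Qbd, z ∈ e}))
    (Finset.inter_subset_right (s₁ := E')) (Finset.inter_subset_right (s₁ := C))
  have hd1 : Disjoint (plainSet p skelVee) (E' ∩ Qbc) := by
    rw [hPS]; exact Finset.disjoint_left.2 fun e he h' => hPQ1 e he (Finset.mem_inter.1 h').2
  have hd2 : Disjoint (plainSet p skelVee ∪ E' ∩ Qbc) (E' ∩ Qbd) := by
    rw [hPS, Finset.disjoint_union_left]
    exact ⟨Finset.disjoint_left.2 fun e he h' => hPQ2 e he (Finset.mem_inter.1 h').2,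
      Finset.disjoint_of_subset_left Finset.inter_subset_right (Finset.disjoint_of_subset_right Finset.inter_subset_right h.d_bc_bd)⟩
  have hval1 : ∀ i ν, 0 ≤ lev2C (E' ∩ Qbc) (C ∩ Qbc) (p 1) (p 2) (p 4) (famGet famP11 i) ν := fun i ν =>
    famP11C_level_nonneg_of_isKNet hbc Finset.inter_subset_right Finset.inter_subset_right hs hsb hsc i ν
  have hval2 : ∀ i ν, 0 ≤ lev2C (E' ∩ Qbd) (C ∩ Qbd) (p 1) (p 3) (p 5) (famGet famP11 i) ν := fun i ν =>
    famP11C_level_nonneg_of_isKNet hbd Finset.inter_subset_right Finset.inter_subset_right ht htb htd i ν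
  have hT := fun μ => veeK_tsym_level_nonneg hinj hLK gE1 gE2 hp1 hp2 h12 hs ht hd1 hd2 hval1 hval2 μ
  have hX := fun μ => veeK_starX_level_nonneg hinj hLK gE1 gE2 hp1 hp2 h12 hs ht hd1 hd2 hval1 hval2 μ
  have hXm := fun μ => veeK_starXm_level_nonneg hinj hLK gE1 gE2 hp1 hp2 h12 hs ht hd1 hd2 hval1 hval2 μ
  have hSt := fun μ => veeK_starS_level_nonneg hinj hLK gE1 gE2 hp1 hp2 h12 hs ht hd1 hd2 hval1 hval2 μ
  -- reading the leaf back on `(E', C)`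
  have hE'N : E' ⊆ ({s(a, b)} : Finset (Sym2 V)) ∪ ({s(a, c)} ∪ {s(a, d)} ∪ Qbc ∪ Qbd ∪ {s(c, d)}) := hE'E.trans hE
  have readE : plainSet p (skelVee.filter fun e => decide (pedge p e ∈ E')) ∪ E' ∩ Qbc ∪ E' ∩ Qbd = E' := by
    ext e
    rw [Finset.mem_union, Finset.mem_union, mem_plainSet_filter, Finset.mem_inter, Finset.mem_inter]
    constructor
    · rintro ((⟨e₀, _, hf, rfl⟩ | ⟨h', _⟩) | ⟨h', _⟩)
      · exact of_decide_eq_true hf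
      · exact h'
      · exact h'
    · intro h'
      by_cases hq1 : e ∈ Qbc
      · exact Or.inl (Or.inr ⟨h', hq1⟩)
      by_cases hq2 : e ∈ Qbd
      · exact Or.inr ⟨h', hq2⟩
      have hP : e ∈ plainSet p skelVee := by rw [hPS]; exact hNP e (hE'N h') hq1 hq2
      obtain ⟨e₀, he₀, rfl⟩ := (mem_plainSet_iff p skelVee e).1 hP
      exact Or.inl (Or.inl ⟨e₀, he₀, decide_eq_true h', rfl⟩)
  have readC : plainSet p (skelVee.filter fun e => decide (pedge p e ∈ C)) ∪ C ∩ Qbc ∪ C ∩ Qbd = C := by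
    ext e
    rw [Finset.mem_union, Finset.mem_union, mem_plainSet_filter, Finset.mem_inter, Finset.mem_inter]
    constructor
    · rintro ((⟨e₀, _, hf, rfl⟩ | ⟨h', _⟩) | ⟨h', _⟩)
      · exact of_decide_eq_true hf
      · exact h'
      · exact h'
    · intro h'
      by_cases hq1 : e ∈ Qbc
      · exact Or.inl (Or.inr ⟨h', hq1⟩)
      by_cases hq2 : e ∈ Qbd
      · exact Or.inr ⟨h', hq2⟩
      have hP : e ∈ plainSet p skelVee := by rw [hPS]; exact hNP e (hC h') hq1 hq2
      obtain ⟨e₀, he₀, rfl⟩ := (mem_plainSet_iff p skelVee e).1 hP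
      exact Or.inl (Or.inl ⟨e₀, he₀, decide_eq_true h', rfl⟩)
  intro μ
  have h1 := hT μ; have h2 := hX μ; have h3 := hXm μ; have h4 := hSt μ
  rw [readE, readC] at h1 h2 h3 h4
  exact ⟨h1, h2, h3, h4⟩

end PlaceVee

end FK

end Summit.CriticalPhenomena.PercolationContinuityZ3.Theorems
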